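import Literature.NumberTheory.EllipticCurves.Sprung2012.ColemanTwistProofs
import Literature.NumberTheory.EllipticCurves.Sprung2012.LocalTowerLayersProofs
import Literature.NumberTheory.EllipticCurves.Kato2004.IwasawaCohomologyExistsProofs
import HarnessLib

/-!
# Sprung 2012, Def. 3.1 / Def. 5.9: the Coleman map is `Λ`-linear — `Λ`-multiples of Coleman
# values are Coleman values (proofs only; no definition, no named fact)

Topic `Literature/NumberTheory/EllipticCurves`, cluster `Sprung2012` (namespace = path). A THEOREMS
file in the vocabulary of `Sprung2012/ColemanMaps.lean` (`localTowerPointsOfEmb`, `pairingSum`,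
`IsColemanPair`), sequel of `ColemanTwistProofs.lean` (the `Γ`-twist `z ↦ z ∘ g⁻¹` multiplies the
Coleman value by `1 + T`). Cell `pub/bsd-cited` (ARM P referee-reader seat `bsd-cited-r18`), first
half of the discharge of the named facts `prop73_colemanFlat_surjective` /
`prop76_colemanSharp_surjective` (Sprung 2012 Props. 7.3 / 7.6, file `ColemanMapImage.lean`); the
second half is `ColemanMapSurjectiveProofs.lean`. Nothing about any curve is asserted; BSD is not
advanced by this file beyond removing trust-base inputs.

## What is proved

F. Sprung, J. Number Theory 132 (2012) [Sprung2012], Definition 3.1 (p. 1489): "`P_{n,x}` is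
`ℤ_p[G_n]`-linear", §2 (p. 1486): "`Λ = ℤ_p[Δ]⟦X⟧`, `γ ↦ 1 + X`", Definition 5.9 (p. 1495): "the
Coleman map `Col : H¹_Iw(T) → Λ ⊕ Λ`" is a homomorphism of `Λ`-modules. In the tree's transcription
(`H¹_Iw(T)` = additive maps `z : E(K_∞·K_v) →+ ℤ_p`, `Col(z) = (L♯, L♭)` iff `IsColemanPair … z L♯ L♭`)
the `Λ`-module structure of `H¹_Iw(T)` is not a definition of the tree; this file proves what the
surjectivity statements need, in existential form:

* `IsColemanPair.exists_mul` — **if `(L♯, L♭)` is a Coleman value (of some `z`), then so is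
  `(λ·L♯, λ·L♭)` for every `λ ∈ Λ = ℤ_p⟦T⟧`** (it is the value of `λ•z`).

The `Λ`-action is built as in print: `T` acts as `γ − 1`, i.e. through the twist
`Θ : z ↦ z ∘ g⁻¹` of `ColemanTwistProofs` (`g` a local lift of the topological generator), a
polynomial `r ∈ ℤ_p[T]` acts as `r(Θ − 1)` (`Polynomial.aeval`), and a power series `λ` acts on the
values at a point `x` of level `n` through ANY polynomial `r ≡ λ (mod ω_n)`, `ω_n = (1+T)^{pⁿ} − 1`
— well defined because `ω_n(Θ − 1) = Θ^{pⁿ} − 1` kills the functionals restricted to `E(K_n·K_v)`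
(`g^{pⁿ}` fixes the `n`-th layer) and because `E(K_∞·K_v) = ⋃_n E(K_n·K_v)`
(`exists_mem_localLayerPointsOfEmb_of_mem_localTowerPointsOfEmb`, file `LocalTowerLayersProofs`).
The existence of `r` is Weierstrass division by the distinguished polynomial `ω_n`, ALREADY in the
tree (`Kato2004.IwasawaH1Exists.isDistinguishedAt_omega`, `…exists_polynomial_sub_coe_mem_span`;
Washington Prop. 7.2, Lang *Cyclotomic Fields* Ch. 5 §1 Thm. 1.1 `Λ ≅ lim← ℤ_p[X]/(ω_n)`). To keep
this a proofs-only file the endomorphism `Θ` is not defined but CHARACTERISED by a hypothesis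
(`hΘ : Θ z y = z (g⁻¹ y)`) and produced once (`exists_twistEnd`).

Contents: §0 `ω_n` in `ℤ_p[X]` versus `Λ` (`toIwasawa_cyclotomicOmega_eq_coe`, polynomial
divisibility from divisibility in `Λ`, `ω_m ∣ ω_n`); §1 `P_{n,x}` is `ℤ_p`-linear and only sees the
orbit (`pairingSum_smul`, `pairingSum_congr`, `IsColemanPair.smul`), layers are `Γ_{K_v}`-stable;
§2 the twist endomorphism and polynomials in it (`exists_twistEnd`, `twistEnd_pow_apply`,
vanishing on a layer propagates, `ω_n·s` kills level-`n` values, congruent polynomials agree on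
level-`n` points, `IsColemanPair.aeval_twistEnd`: `Col(r(Θ−1)z) = r·Col(z)`); §3 the gluing and
`IsColemanPair.exists_mul`.

## References
* [Sprung2012] F. E. I. Sprung, J. Number Theory 132 (2012) 1483–1506: §2 p. 1486 (`Λ`, `γ ↦ 1+X`),
  Def. 3.1 (p. 1489), Def. 5.9 (p. 1495), Lemma 7.10 (p. 1503).
* [Washington1997] L. C. Washington, *Introduction to Cyclotomic Fields*, Prop. 7.2, Thm. 7.1.
* [Lang1990] S. Lang, *Cyclotomic Fields I and II*, Ch. 5 §1 Thm. 1.1.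
* Tree: `Sprung2012/ColemanMaps.lean`, `ColemanTwistProofs.lean`, `LocalTowerTraceProofs.lean`,
  `LocalTowerLayersProofs.lean`; `Kato2004/IwasawaCohomologyExistsProofs.lean` (§ Algebra).
-/

noncomputable section

open scoped Classical

open Polynomial

universe u

namespace Literature.NumberTheory.EllipticCurves.Sprung2012

open Literature.NumberTheory.EllipticCurves Literature.NumberTheory.GaloisRepresentations ZpExtension
  Literature.NumberTheory.EllipticCurves.Kobayashi2003 Literature.NumberTheory.EllipticCurves.Sprung2017
  Literature.NumberTheory.EllipticCurves.Kato2004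

/-! ## §0 `ω_n = (X+1)^{pⁿ} − 1` in `ℤ_p[X]` and in `Λ` -/

section Omega

variable {p : ℕ} [Fact p.Prime]

variable (p) in
/-- `ω_n ∈ ℤ[X]` maps to the coercion of `(X+1)^{pⁿ} − 1 ∈ ℤ_p[X]` in `Λ = ℤ_p⟦X⟧`.
[cite: Washington1997, §7.1 (distinguished polynomials)] -/
theorem toIwasawa_cyclotomicOmega_eq_coe (n : ℕ) :
    toIwasawa p (cyclotomicOmega p n) =
      (((X + 1 : ℤ_[p][X]) ^ p ^ n - 1 : ℤ_[p][X]) : PowerSeries ℤ_[p]) := by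
  change (((cyclotomicOmega p n).map (Int.castRingHom ℤ_[p]) : ℤ_[p][X]) : PowerSeries ℤ_[p]) = _
  rw [cyclotomicOmega, Polynomial.map_sub, Polynomial.map_pow, Polynomial.map_add, Polynomial.map_X,
    Polynomial.map_one]

/-- **Polynomial divisibility by `ω_n` from divisibility in `Λ`**: `ℤ_p[X]/(ω_n) → Λ/(ω_n)` is
injective (it is the isomorphism of Weierstrass division by the distinguished `ω_n`, Washington
Prop. 7.2; tree: `Kato2004.IwasawaH1Exists.isDistinguishedAt_omega` with Mathlib's
`Polynomial.IsDistinguishedAt.algEquivQuotient`). [cite: Washington1997, Prop. 7.2] -/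
theorem omega_dvd_of_coe_dvd {n : ℕ} {r : ℤ_[p][X]}
    (h : (((X + 1 : ℤ_[p][X]) ^ p ^ n - 1 : ℤ_[p][X]) : PowerSeries ℤ_[p]) ∣ (r : PowerSeries ℤ_[p])) :
    ((X + 1 : ℤ_[p][X]) ^ p ^ n - 1) ∣ r := by
  set ω : ℤ_[p][X] := (X + 1 : ℤ_[p][X]) ^ p ^ n - 1 with hω
  set e := (IwasawaH1Exists.isDistinguishedAt_omega p n).algEquivQuotient with he
  have h1 : Ideal.Quotient.mk (Ideal.span {(ω : PowerSeries ℤ_[p])}) (r : PowerSeries ℤ_[p]) = 0 := by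
    rw [Ideal.Quotient.eq_zero_iff_mem, Ideal.mem_span_singleton]
    exact h
  have h2 : e (Ideal.Quotient.mk _ r) = Ideal.Quotient.mk _ (r : PowerSeries ℤ_[p]) := by
    simp [he, Polynomial.IsDistinguishedAt.algEquivQuotient]
  have h3 : Ideal.Quotient.mk (Ideal.span {ω}) r = 0 := by
    apply e.injective
    rw [h2, h1, map_zero]
  rwa [Ideal.Quotient.eq_zero_iff_mem, Ideal.mem_span_singleton] at h3

omit [Fact p.Prime] in
variable (p) in
/-- `ω_m ∣ ω_n` in `ℤ[X]` for `m ≤ n` (`(X+1)^{pⁿ} − 1 = Y^{p^{n−m}} − 1`, `Y = (X+1)^{p^m}`; the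
transition maps of `Λ ≅ lim← ℤ_p[X]/(ω_n)`). [cite: Washington1997, Thm. 7.1] -/
theorem cyclotomicOmega_dvd_cyclotomicOmega_of_le {m n : ℕ} (h : m ≤ n) :
    cyclotomicOmega p m ∣ cyclotomicOmega p n := by
  obtain ⟨d, rfl⟩ := Nat.exists_eq_add_of_le h
  have := sub_dvd_pow_sub_pow ((X + 1 : ℤ[X]) ^ p ^ m) 1 (p ^ d)
  rwa [one_pow, ← pow_mul, ← pow_add] at this

variable (p) in
/-- **Weierstrass division by `ω_n`** (Washington Prop. 7.2), in the form used here: every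
`λ ∈ Λ = ℤ_p⟦T⟧` is congruent modulo `ω_n` to a polynomial `r ∈ ℤ_p[T]`
(tree: `Kato2004.IwasawaH1Exists.exists_polynomial_sub_coe_mem_span`). [cite: Washington1997, Prop. 7.2] -/
theorem exists_polynomial_toIwasawa_cyclotomicOmega_dvd_sub (n : ℕ) (f : IwasawaAlgebra p) :
    ∃ r : ℤ_[p][X], toIwasawa p (cyclotomicOmega p n) ∣ f - (r : PowerSeries ℤ_[p]) := by
  obtain ⟨r, hr⟩ := IwasawaH1Exists.exists_polynomial_sub_coe_mem_span p n f
  refine ⟨r, ?_⟩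
  rw [toIwasawa_cyclotomicOmega_eq_coe]
  exact Ideal.mem_span_singleton.mp hr

/-- `ω_n(θ − 1) = θ^{pⁿ} − 1` for an endomorphism `θ` (substituting `X ↦ θ − 1`). [folklore] -/
private theorem aeval_sub_one_omega_eq {M : Type*} [AddCommGroup M] [Module ℤ_[p] M]
    (θ : Module.End ℤ_[p] M) (n : ℕ) :
    aeval (θ - 1) ((X + 1 : ℤ_[p][X]) ^ p ^ n - 1) = θ ^ p ^ n - 1 := by
  simp [map_sub, map_pow, map_add, aeval_X, sub_add_cancel]

end Omega

section Local

variable {K : Type u} [Field K] {p : ℕ} [Fact p.Prime] (κ : ZpExtension K p)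
variable {E : Type u} [Field E] [Algebra K E] (ι : AlgebraicClosure K →ₐ[K] AlgebraicClosure E)
variable (W : WeierstrassCurve K)

/-! ## §1 `P_{n,x}` is `ℤ_p`-linear and only sees the orbit; layers are `Γ_{K_v}`-stable -/

/-- The layer `E(K_n·K_v)` is stable under `Γ_{K_v}` (`Gal(K̄_v/K_n·K_v)` is normal in `Γ_{K_v}`,
being the preimage of the normal subgroup `κ⁻¹(pⁿℤ_p)`). [cite: Kobayashi2003, Def. 1.1 (E(F_{n,p}) is a Gal-module)] -/
theorem smul_mem_localLayerPointsOfEmb (n : ℕ) (g : Field.absoluteGaloisGroup E) {P : localPoints W E}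
    (hP : P ∈ localLayerPointsOfEmb κ ι W n) : g • P ∈ localLayerPointsOfEmb κ ι W n := by
  rw [mem_localLayerPointsOfEmb_iff] at hP ⊢
  intro τ hτ
  have hconj : g⁻¹ * τ * g ∈ localLayerSubgroupOfEmb κ ι n := by
    rw [localLayerSubgroupOfEmb, mem_localSubgroupOfEmb_iff] at hτ ⊢
    rw [map_mul, map_mul, map_inv]
    exact (κ.layerSubgroup_normal n).conj_mem' _ hτ _
  have h := hP _ hconj
  calc τ • g • P = (g * (g⁻¹ * τ * g)) • P := by rw [← mul_smul]; congr 1; group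
    _ = g • P := by rw [mul_smul, h]

/-- `P_{n,x}` is `ℤ_p`-linear in the functional: `P_{n,x}(a·z) = a·P_{n,x}(z)`.
[cite: Sprung2012, Def. 3.1 (p. 1489) ("By linearity")] -/
theorem pairingSum_smul (A : AddSubgroup (localPoints W E)) (g : Field.absoluteGaloisGroup E) (n : ℕ)
    (x : localPoints W E) (a : ℤ_[p]) (z : A →+ ℤ_[p]) :
    pairingSum W A g n x (a • z) = PowerSeries.C a * pairingSum W A g n x z := by
  rw [pairingSum_def, pairingSum_def, Finset.mul_sum]
  refine Finset.sum_congr rfl fun j _ => ?_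
  by_cases h : g ^ j • x ∈ A
  · rw [evalOn_of_mem W A _ h, evalOn_of_mem W A _ h, AddMonoidHom.smul_apply, smul_eq_mul, map_mul,
      mul_assoc]
  · rw [evalOn_of_not_mem W A _ h, evalOn_of_not_mem W A _ h, map_zero, zero_mul, mul_zero]

/-- `P_{n,x}(z)` only depends on the values of `z` on the orbit `{gʲx : j < pⁿ}`.
[cite: Sprung2012, Def. 3.1 (p. 1489)] -/
theorem pairingSum_congr (A : AddSubgroup (localPoints W E)) (g : Field.absoluteGaloisGroup E) (n : ℕ)
    (x : localPoints W E) {z z' : A →+ ℤ_[p]}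
    (h : ∀ j < p ^ n, evalOn W A z (g ^ j • x) = evalOn W A z' (g ^ j • x)) :
    pairingSum W A g n x z = pairingSum W A g n x z' := by
  rw [pairingSum_def, pairingSum_def]
  exact Finset.sum_congr rfl fun j hj => by rw [h j (Finset.mem_range.mp hj)]

variable {κ ι W}

/-- Coleman values scale: `Col(a·z) = a·Col(z)` for `a ∈ ℤ_p`.
[cite: Sprung2012, Def. 5.9 (p. 1495) (Col is a homomorphism of Λ-modules)] -/
theorem IsColemanPair.smul {ap : ℤ} {g : Field.absoluteGaloisGroup E} {c : ℕ → localPoints W E}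
    {z : localTowerPointsOfEmb κ ι W →+ ℤ_[p]} {Ls Lf : IwasawaAlgebra p}
    (h : IsColemanPair κ ι W ap g c z Ls Lf) (a : ℤ_[p]) :
    IsColemanPair κ ι W ap g c (a • z) (PowerSeries.C a * Ls) (PowerSeries.C a * Lf) := by
  intro n
  rw [pairingSum_smul]
  have key : PowerSeries.C a * pairingSum W (localTowerPointsOfEmb κ ι W) g n (c n) z +
      (toIwasawa p (sharpPoly ap p n) * (PowerSeries.C a * Ls) +
        toIwasawa p (flatPoly ap p n) * (PowerSeries.C a * Lf)) =
      PowerSeries.C a * (pairingSum W (localTowerPointsOfEmb κ ι W) g n (c n) z +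
        (toIwasawa p (sharpPoly ap p n) * Ls + toIwasawa p (flatPoly ap p n) * Lf)) := by ring
  rw [key]
  exact dvd_mul_of_dvd_right (h n) _

/-! ## §2 The twist endomorphism `Θ : z ↦ z ∘ g⁻¹` of `H¹_Iw(T)` and polynomials in it -/

variable (κ ι W)

/-- The twist `z ↦ z ∘ g⁻¹` of `ColemanTwistProofs.exists_twist`, as a `ℤ_p`-linear endomorphism
`Θ` of the functionals on `E(K_∞·K_v)` (the action of `γ`, Sprung's "`γ ↦ 1 + X`").
[cite: Sprung2012, §2 p. 1486 and Def. 3.1 (p. 1489) (the G_n-action)] -/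
theorem exists_twistEnd (g : Field.absoluteGaloisGroup E) :
    ∃ Θ : Module.End ℤ_[p] (localTowerPointsOfEmb κ ι W →+ ℤ_[p]),
      ∀ (z : localTowerPointsOfEmb κ ι W →+ ℤ_[p]) (y : localTowerPointsOfEmb κ ι W),
        Θ z y = z ⟨g⁻¹ • (y : localPoints W E), smul_mem_localTowerPointsOfEmb κ ι W g⁻¹ y.2⟩ := by
  let φ : localTowerPointsOfEmb κ ι W →+ localTowerPointsOfEmb κ ι W :=
    { toFun := fun y ↦ ⟨g⁻¹ • (y : localPoints W E), smul_mem_localTowerPointsOfEmb κ ι W g⁻¹ y.2⟩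
      map_zero' := Subtype.ext (by simp)
      map_add' := fun a b ↦ Subtype.ext (by simp [smul_add]) }
  refine ⟨{ toFun := fun z ↦ z.comp φ
            map_add' := fun z z' ↦ AddMonoidHom.ext fun _ ↦ rfl
            map_smul' := fun a z ↦ AddMonoidHom.ext fun _ ↦ rfl }, fun z y ↦ rfl⟩

variable {κ ι W}

/-- Powers of the twist: `(Θᵏ z)(y) = z(g^{−k} y)`. [cite: Sprung2012, Def. 3.1 (p. 1489) (the G_n-action)] -/
theorem twistEnd_pow_apply {g : Field.absoluteGaloisGroup E}
    {Θ : Module.End ℤ_[p] (localTowerPointsOfEmb κ ι W →+ ℤ_[p])}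
    (hΘ : ∀ (z : localTowerPointsOfEmb κ ι W →+ ℤ_[p]) (y : localTowerPointsOfEmb κ ι W),
      Θ z y = z ⟨g⁻¹ • (y : localPoints W E), smul_mem_localTowerPointsOfEmb κ ι W g⁻¹ y.2⟩)
    (k : ℕ) (z : localTowerPointsOfEmb κ ι W →+ ℤ_[p]) (y : localTowerPointsOfEmb κ ι W) :
    (Θ ^ k) z y = z ⟨(g ^ k)⁻¹ • (y : localPoints W E),
      smul_mem_localTowerPointsOfEmb κ ι W (g ^ k)⁻¹ y.2⟩ := by
  induction k generalizing z y with
  | zero =>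
    simp only [pow_zero, Module.End.one_apply, inv_one, one_smul]
  | succ k ih =>
    rw [pow_succ, Module.End.mul_apply, ih, hΘ]
    congr 1
    apply Subtype.ext
    change g⁻¹ • (g ^ k)⁻¹ • (y : localPoints W E) = (g ^ (k + 1))⁻¹ • (y : localPoints W E)
    rw [← mul_smul, ← mul_inv_rev, ← pow_succ]

/-- If a functional `w` vanishes on the layer `E(K_n·K_v)` then so does `r(Θ − 1)·w` for every
polynomial `r` (the layer is `Γ_{K_v}`-stable). [cite: Sprung2012, Def. 3.1 (p. 1489)] -/
theorem aeval_twistEnd_apply_eq_zero_of_forall {g : Field.absoluteGaloisGroup E}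
    {Θ : Module.End ℤ_[p] (localTowerPointsOfEmb κ ι W →+ ℤ_[p])}
    (hΘ : ∀ (z : localTowerPointsOfEmb κ ι W →+ ℤ_[p]) (y : localTowerPointsOfEmb κ ι W),
      Θ z y = z ⟨g⁻¹ • (y : localPoints W E), smul_mem_localTowerPointsOfEmb κ ι W g⁻¹ y.2⟩)
    {n : ℕ} {w : localTowerPointsOfEmb κ ι W →+ ℤ_[p]}
    (hw : ∀ (y : localPoints W E) (hy : y ∈ localLayerPointsOfEmb κ ι W n),
      w ⟨y, localLayerPointsOfEmb_le_localTowerPointsOfEmb κ ι W n hy⟩ = 0)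
    (r : ℤ_[p][X]) :
    ∀ (x : localPoints W E) (hx : x ∈ localLayerPointsOfEmb κ ι W n),
      (aeval (Θ - 1) r w) ⟨x, localLayerPointsOfEmb_le_localTowerPointsOfEmb κ ι W n hx⟩ = 0 := by
  induction r using Polynomial.induction_on with
  | C a =>
    intro x hx
    rw [aeval_C, Module.algebraMap_end_apply, AddMonoidHom.smul_apply, hw x hx, smul_zero]
  | add r s hr hs =>
    intro x hx
    rw [map_add, LinearMap.add_apply, AddMonoidHom.add_apply, hr x hx, hs x hx, add_zero]
  | monomial k a ih =>
    intro x hx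
    have e : C a * X ^ (k + 1) = X * (C a * X ^ k) := by ring
    rw [e, map_mul, Module.End.mul_apply, aeval_X, LinearMap.sub_apply, Module.End.one_apply,
      AddMonoidHom.sub_apply, hΘ, ih x hx, sub_zero]
    have hgx : g⁻¹ • x ∈ localLayerPointsOfEmb κ ι W n := smul_mem_localLayerPointsOfEmb κ ι W n g⁻¹ hx
    exact ih (g⁻¹ • x) hgx

/-- **`ω_n` kills the values on `E(K_n·K_v)`**: for `x` of level `n` and any polynomial `s`,
`((ω_n·s)(Θ − 1)·z)(x) = 0`, because `ω_n(Θ − 1) = Θ^{pⁿ} − 1` and `g^{pⁿ}` fixes `x`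
(`Γ_n = Gal(k_∞/k_n)`, Sprung §2 p. 1486; `Λ_n = Λ/ω_n = ℤ_p[G_n]` acts on `H¹(k_n, T)`).
[cite: Sprung2012, §2 p. 1486 and Def. 3.1 (p. 1489)] -/
theorem aeval_twistEnd_omega_mul_apply_eq_zero {g : Field.absoluteGaloisGroup E}
    (hg : κ.IsTopGenerator (resGalOfEmb ι g))
    {Θ : Module.End ℤ_[p] (localTowerPointsOfEmb κ ι W →+ ℤ_[p])}
    (hΘ : ∀ (z : localTowerPointsOfEmb κ ι W →+ ℤ_[p]) (y : localTowerPointsOfEmb κ ι W),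
      Θ z y = z ⟨g⁻¹ • (y : localPoints W E), smul_mem_localTowerPointsOfEmb κ ι W g⁻¹ y.2⟩)
    (n : ℕ) (s : ℤ_[p][X]) (z : localTowerPointsOfEmb κ ι W →+ ℤ_[p])
    {x : localPoints W E} (hx : x ∈ localLayerPointsOfEmb κ ι W n) :
    (aeval (Θ - 1) (((X + 1 : ℤ_[p][X]) ^ p ^ n - 1) * s) z)
      ⟨x, localLayerPointsOfEmb_le_localTowerPointsOfEmb κ ι W n hx⟩ = 0 := by
  rw [mul_comm, map_mul, Module.End.mul_apply]
  refine aeval_twistEnd_apply_eq_zero_of_forall hΘ (fun y hy ↦ ?_) s x hx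
  rw [aeval_sub_one_omega_eq, LinearMap.sub_apply, Module.End.one_apply, AddMonoidHom.sub_apply,
    twistEnd_pow_apply hΘ, sub_eq_zero]
  congr 1
  apply Subtype.ext
  change (g ^ p ^ n)⁻¹ • y = y
  rw [inv_smul_eq_iff]
  have h := pow_mul_smul_of_mem_localLayerPointsOfEmb κ ι W hg hy 1
  rw [mul_one] at h
  exact h.symm

/-- **Congruent polynomials act alike on level-`n` values**: if `ω_n ∣ r − r'` in `ℤ_p[X]` then
`(r(Θ−1)z)(x) = (r'(Θ−1)z)(x)` for `x ∈ E(K_n·K_v)` — the action of `Λ_n = ℤ_p[X]/(ω_n)` on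
`H¹(k_n, T)`. [cite: Sprung2012, §2 p. 1486 and Def. 3.1 (p. 1489)] -/
theorem aeval_twistEnd_apply_eq_of_omega_dvd_sub {g : Field.absoluteGaloisGroup E}
    (hg : κ.IsTopGenerator (resGalOfEmb ι g))
    {Θ : Module.End ℤ_[p] (localTowerPointsOfEmb κ ι W →+ ℤ_[p])}
    (hΘ : ∀ (z : localTowerPointsOfEmb κ ι W →+ ℤ_[p]) (y : localTowerPointsOfEmb κ ι W),
      Θ z y = z ⟨g⁻¹ • (y : localPoints W E), smul_mem_localTowerPointsOfEmb κ ι W g⁻¹ y.2⟩)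
    {n : ℕ} {r r' : ℤ_[p][X]} (h : ((X + 1 : ℤ_[p][X]) ^ p ^ n - 1) ∣ r - r')
    (z : localTowerPointsOfEmb κ ι W →+ ℤ_[p]) {x : localPoints W E}
    (hx : x ∈ localLayerPointsOfEmb κ ι W n) :
    (aeval (Θ - 1) r z) ⟨x, localLayerPointsOfEmb_le_localTowerPointsOfEmb κ ι W n hx⟩ =
      (aeval (Θ - 1) r' z) ⟨x, localLayerPointsOfEmb_le_localTowerPointsOfEmb κ ι W n hx⟩ := by
  obtain ⟨s, hs⟩ := h
  have e : r = r' + ((X + 1 : ℤ_[p][X]) ^ p ^ n - 1) * s := by rw [← hs]; ring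
  rw [e, map_add, LinearMap.add_apply, AddMonoidHom.add_apply,
    aeval_twistEnd_omega_mul_apply_eq_zero hg hΘ n s z hx, add_zero]

/-- **`Col(r(Θ−1)·z) = r·Col(z)` for polynomials `r ∈ ℤ_p[T]`** — the `ℤ_p[G_n]`-linearity of
`P_{n,x}` (Def. 3.1) / `Λ`-linearity of `Col` (Def. 5.9), by induction on `r` from
`IsColemanPair.add`, `IsColemanPair.smul` and the twist `IsColemanPair.twist_sub`
(`Col(z∘g⁻¹ − z) = T·Col(z)`). [cite: Sprung2012, Def. 3.1 (p. 1489) and Def. 5.9 (p. 1495)] -/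
theorem IsColemanPair.aeval_twistEnd {ap : ℤ} {g : Field.absoluteGaloisGroup E}
    (hg : κ.IsTopGenerator (resGalOfEmb ι g)) {c : ℕ → localPoints W E}
    (hc : ∀ n, c n ∈ localLayerPointsOfEmb κ ι W n)
    {Θ : Module.End ℤ_[p] (localTowerPointsOfEmb κ ι W →+ ℤ_[p])}
    (hΘ : ∀ (z : localTowerPointsOfEmb κ ι W →+ ℤ_[p]) (y : localTowerPointsOfEmb κ ι W),
      Θ z y = z ⟨g⁻¹ • (y : localPoints W E), smul_mem_localTowerPointsOfEmb κ ι W g⁻¹ y.2⟩)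
    {z : localTowerPointsOfEmb κ ι W →+ ℤ_[p]} {Ls Lf : IwasawaAlgebra p}
    (h : IsColemanPair κ ι W ap g c z Ls Lf) (r : ℤ_[p][X]) :
    IsColemanPair κ ι W ap g c (aeval (Θ - 1) r z) ((r : PowerSeries ℤ_[p]) * Ls)
      ((r : PowerSeries ℤ_[p]) * Lf) := by
  induction r using Polynomial.induction_on with
  | C a =>
    rw [aeval_C, Module.algebraMap_end_apply, Polynomial.coe_C]
    exact h.smul a
  | add r s hr hs =>
    rw [map_add, LinearMap.add_apply, Polynomial.coe_add, add_mul, add_mul]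
    exact hr.add hs
  | monomial k a ih =>
    have e : C a * X ^ (k + 1) = X * (C a * X ^ k) := by ring
    rw [e, map_mul, Module.End.mul_apply, aeval_X, Polynomial.coe_mul, Polynomial.coe_X, mul_assoc,
      mul_assoc, LinearMap.sub_apply, Module.End.one_apply]
    exact ih.twist_sub κ ι W hg hc (fun y ↦ hΘ _ y)

/-! ## §3 Gluing over `E(K_∞·K_v) = ⋃_n E(K_n·K_v)`: `Λ`-multiples of Coleman values -/

/-- **`Λ`-multiples of Coleman values are Coleman values** (Sprung 2012 Def. 5.9: `Col` is a
homomorphism of `Λ`-modules, `Λ = ℤ_p⟦T⟧`, `γ ↦ 1 + T`): if `Col(z) = (L♯, L♭)` for a functional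
`z` on `E(K_∞·K_v)` (points `c_n` of level `n`, `g` a local lift of the topological generator), then
for every `λ ∈ Λ` there is a functional `z' = λ•z` with `Col(z') = (λ·L♯, λ·L♭)`. Construction:
on `x ∈ E(K_n·K_v)`, `z'(x) = (r_n(Θ−1)·z)(x)` for any polynomial `r_n ≡ λ (mod ω_n)` (Weierstrass
division), independent of the choices by `aeval_twistEnd_apply_eq_of_omega_dvd_sub`, additive by
`exists_mem_localLayerPointsOfEmb_pair`; then `P_{n,c_n}(z') = P_{n,c_n}(r_n(Θ−1)z) ≡ r_n·P_{n,c_n}(z)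
≡ λ·P_{n,c_n}(z)` modulo `ω_n` by `IsColemanPair.aeval_twistEnd`.
[cite: Sprung2012, Def. 5.9 (p. 1495), Def. 3.1 (p. 1489), §2 p. 1486, Lemma 7.10 (p. 1503)]
[cite: Washington1997, Prop. 7.2 and Thm. 7.1] -/
theorem IsColemanPair.exists_mul {ap : ℤ} {g : Field.absoluteGaloisGroup E}
    (hg : κ.IsTopGenerator (resGalOfEmb ι g)) {c : ℕ → localPoints W E}
    (hc : ∀ n, c n ∈ localLayerPointsOfEmb κ ι W n)
    {z : localTowerPointsOfEmb κ ι W →+ ℤ_[p]} {Ls Lf : IwasawaAlgebra p}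
    (h : IsColemanPair κ ι W ap g c z Ls Lf) (lam : IwasawaAlgebra p) :
    ∃ z' : localTowerPointsOfEmb κ ι W →+ ℤ_[p], IsColemanPair κ ι W ap g c z' (lam * Ls) (lam * Lf) := by
  have hle := fun n ↦ localLayerPointsOfEmb_le_localTowerPointsOfEmb κ ι W n
  obtain ⟨Θ, hΘ⟩ := exists_twistEnd κ ι W g
  -- polynomial representatives `ρ n ≡ lam (mod ω_n)`
  choose ρ hρ using fun n ↦ exists_polynomial_toIwasawa_cyclotomicOmega_dvd_sub p n lam
  -- the value at a point does not depend on the level used to compute it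
  have hindep : ∀ (m n : ℕ) (x : localPoints W E) (hm : x ∈ localLayerPointsOfEmb κ ι W m)
      (hn : x ∈ localLayerPointsOfEmb κ ι W n),
      (aeval (Θ - 1) (ρ m) z) ⟨x, hle m hm⟩ = (aeval (Θ - 1) (ρ n) z) ⟨x, hle n hn⟩ := by
    intro m n x hm hn
    wlog hmn : m ≤ n generalizing m n
    · exact (this n m hn hm (le_of_not_ge hmn)).symm
    refine aeval_twistEnd_apply_eq_of_omega_dvd_sub hg hΘ (omega_dvd_of_coe_dvd ?_) z hm
    rw [← toIwasawa_cyclotomicOmega_eq_coe, Polynomial.coe_sub,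
      show ((ρ m : ℤ_[p][X]) : PowerSeries ℤ_[p]) - ((ρ n : ℤ_[p][X]) : PowerSeries ℤ_[p]) =
        (lam - ((ρ n : ℤ_[p][X]) : PowerSeries ℤ_[p])) -
          (lam - ((ρ m : ℤ_[p][X]) : PowerSeries ℤ_[p])) by ring]
    exact dvd_sub ((map_dvd (toIwasawa p) (cyclotomicOmega_dvd_cyclotomicOmega_of_le p hmn)).trans
      (hρ n)) (hρ m)
  -- a level for every point of the tower
  have hlev : ∀ x : localTowerPointsOfEmb κ ι W, ∃ n, (x : localPoints W E) ∈ localLayerPointsOfEmb κ ι W n :=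
    fun x ↦ exists_mem_localLayerPointsOfEmb_of_mem_localTowerPointsOfEmb κ ι W x.2
  choose lv hlv using hlev
  -- the glued values
  have hF : ∀ (n : ℕ) (x : localTowerPointsOfEmb κ ι W)
      (hx : (x : localPoints W E) ∈ localLayerPointsOfEmb κ ι W n),
      (aeval (Θ - 1) (ρ (lv x)) z) x = (aeval (Θ - 1) (ρ n) z) x := fun n x hx ↦
    hindep (lv x) n (x : localPoints W E) (hlv x) hx
  let z' : localTowerPointsOfEmb κ ι W →+ ℤ_[p] :=
    { toFun := fun x ↦ (aeval (Θ - 1) (ρ (lv x)) z) x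
      map_zero' := by
        change (aeval (Θ - 1) (ρ (lv 0)) z) 0 = 0
        rw [map_zero]
      map_add' := fun x y ↦ by
        obtain ⟨N, hx, hy⟩ := exists_mem_localLayerPointsOfEmb_pair κ ι W x.2 y.2
        change (aeval (Θ - 1) (ρ (lv (x + y))) z) (x + y) =
          (aeval (Θ - 1) (ρ (lv x)) z) x + (aeval (Θ - 1) (ρ (lv y)) z) y
        rw [hF N x hx, hF N y hy, hF N (x + y) (add_mem hx hy), map_add] }
  have hz' : ∀ x : localTowerPointsOfEmb κ ι W, z' x = (aeval (Θ - 1) (ρ (lv x)) z) x := fun x ↦ rfl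
  refine ⟨z', fun n ↦ ?_⟩
  -- level `n`: `P_{n,c_n}(z') = P_{n,c_n}(ρ_n(Θ−1)·z)`
  have hcn : ∀ j : ℕ, g ^ j • c n ∈ localLayerPointsOfEmb κ ι W n := fun j ↦
    smul_mem_localLayerPointsOfEmb κ ι W n _ (hc n)
  have hcT : ∀ j : ℕ, g ^ j • c n ∈ localTowerPointsOfEmb κ ι W := fun j ↦ hle n (hcn j)
  have hP : pairingSum W (localTowerPointsOfEmb κ ι W) g n (c n) z' =
      pairingSum W (localTowerPointsOfEmb κ ι W) g n (c n) (aeval (Θ - 1) (ρ n) z) := by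
    refine pairingSum_congr W _ g n (c n) fun j _ ↦ ?_
    rw [evalOn_of_mem W _ _ (hcT j), evalOn_of_mem W _ _ (hcT j), hz']
    exact hF n ⟨_, hcT j⟩ (hcn j)
  rw [hP]
  have hpoly := (h.aeval_twistEnd hg hc hΘ (ρ n)) n
  have hd : toIwasawa p (cyclotomicOmega p n) ∣
      (toIwasawa p (sharpPoly ap p n) * (lam * Ls) + toIwasawa p (flatPoly ap p n) * (lam * Lf)) -
        (toIwasawa p (sharpPoly ap p n) * (((ρ n : ℤ_[p][X]) : PowerSeries ℤ_[p]) * Ls) +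
          toIwasawa p (flatPoly ap p n) * (((ρ n : ℤ_[p][X]) : PowerSeries ℤ_[p]) * Lf)) := by
    have e : (toIwasawa p (sharpPoly ap p n) * (lam * Ls) + toIwasawa p (flatPoly ap p n) * (lam * Lf)) -
        (toIwasawa p (sharpPoly ap p n) * (((ρ n : ℤ_[p][X]) : PowerSeries ℤ_[p]) * Ls) +
          toIwasawa p (flatPoly ap p n) * (((ρ n : ℤ_[p][X]) : PowerSeries ℤ_[p]) * Lf)) =
        (lam - ((ρ n : ℤ_[p][X]) : PowerSeries ℤ_[p])) *
          (toIwasawa p (sharpPoly ap p n) * Ls + toIwasawa p (flatPoly ap p n) * Lf) := by ring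
    rw [e]
    exact dvd_mul_of_dvd_left (hρ n) _
  have := dvd_add hpoly hd
  convert this using 1
  ring

end Local

end Literature.NumberTheory.EllipticCurves.Sprung2012

end
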